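import Summits.AtomisticToContinuum.BoseEinsteinCondensation.Theorems.BECThomsonPrincipleDensityResponseTransportState
import Literature.MathematicalPhysics.QuantumManyBody.PeriodicCellChangeOfVariables

/-!
# Route `BECThomsonPrinciple`, crux `DensityResponse` (stmt-AtomisticToContinuum-9481),
# line `force-balance-constitutive` — sub-goal `stub_transportedState` of stub S1
# (`TransportStationary`)

The TRANSPORTED STATE of the transport step of S1 as an admissible periodic trial state, and the
group law of the transport. With the configuration-space flow `F_τ = transportFlow L n τ`
(`Theorems/BECThomsonPrincipleDensityResponseTransportFlow.lean`) and the transported wave function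
`Φ^τ = transportFun L n τ ψ = (ψ ∘ F_{-τ}) · J_τ`, `J_τ = transportWeight L n τ = (det DF_{-τ})^{1/2}`
(`Theorems/BECThomsonPrincipleDensityResponseTransportState.lean`):

* NORMALISATION `∫_cell ‖Φ^τ‖² = ∫_cell ‖ψ‖² = 1` for `L > 0`, `n ≠ 0`: the push-forward density
  identity `‖Φ^τ‖² = ‖ψ ∘ F_{-τ}‖² · |det DF_{-τ}|` is the integrand of the change-of-variables
  formula on the flat torus for the lattice-equivariant `C¹` bijection `F_{-τ}`
  (`Literature.MathematicalPhysics.QuantumManyBody.BoseGas.lintegral_cellN_comp_equivariant`);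
* the transported state `Φ.transport hL hn τ : PeriodicTrialState N L` (wave function `Φ^τ`;
  `C¹`, lattice periodic, Bose symmetric, normalised), a dot-notation extension of the Literature
  structure `PeriodicTrialState` declared with its absolute name, and `Φ.transport hL hn 0 = Φ`;
* the JACOBIAN COCYCLE `D(s + t, θ) = D(t, θ) · D(s, θ + δ(t, θ))` of the angle flow
  (`D(τ, θ) = cosh τ - cos θ sinh τ = (∂_θ(θ + δ(τ, θ)))⁻¹`), the weight cocycle
  `J_{τ+σ}(X) = J_τ(X) · J_σ(F_{-τ} X)` and the GROUP LAW `(Φ^σ)^τ = Φ^{τ+σ}`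
  (`transportFun_transportFun`; `e^{-τD} e^{-σD} = e^{-(τ+σ)D}`), hence
  `(Φ.transport σ).transport τ = Φ.transport (τ + σ)`.

* FLATTENING `∫_cell g |Φ^τ|² = ∫_cell (g ∘ F_τ) |ψ|²` for lattice-periodic weights `g` (Bochner
  torus change of variables), whence the flattened density wave and effective number
  `m(Φ^τ) = ∫ (∑ᵢ 2cos(θᵢ + δ(τ,θᵢ))) |Φ|²`, `N_eff(Φ^τ) = ∫ (∑ᵢ 2sin²(θᵢ + δ(τ,θᵢ))) |Φ|²`.

The registered sub-goal `stub_transportedState` packages the normalisation and the group law.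
Elementary; no named facts.
-/

namespace Summit.AtomisticToContinuum.BoseEinsteinCondensation.Cruxes.DensityResponse.ForceBalanceConstitutive

noncomputable section

open Real MeasureTheory
open scoped ENNReal
open Literature.MathematicalPhysics.QuantumManyBody.BoseGas

variable {N : ℕ}

/-! ### Normalisation of the transported wave function -/

/-- **NORMALISATION** `∫_cell ‖Φ^τ‖₊² = 1`: change of variables `Y = F_{-τ} X` on the flat torus
(`lintegral_cellN_comp_equivariant` with the lattice-equivariant `C¹` bijection `F_{-τ}`) applied
to the push-forward density `‖Φ^τ(X)‖² = ‖ψ(F_{-τ}X)‖² |det DF_{-τ}(X)|`. [folklore] -/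
theorem lintegral_nnnorm_sq_transportFun {L : ℝ} (hL : 0 < L) {n : Fin 3 → ℤ} (hn : n ≠ 0)
    (Φ : PeriodicTrialState N L) (τ : ℝ) :
    ∫⁻ X in cellN N L, (‖transportFun L n τ Φ.ψ X‖₊ : ℝ≥0∞) ^ 2 = 1 := by
  have hk : ksq L n ≠ 0 := (ksq_pos hL.ne' hn).ne'
  simp_rw [nnnorm_sq_transportFun_eq_det hk]
  rw [lintegral_cellN_comp_equivariant hL (hasFDerivAt_transportFlow L n (-τ))
    (bijective_transportFlow L n (-τ)) (transportFlow_add_single L n (-τ))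
    (G := fun X => (‖Φ.ψ X‖₊ : ℝ≥0∞) ^ 2) (fun X i c => by simp only [Φ.periodic])]
  exact Φ.norm_eq

/-- Bochner form of the normalisation: `∫_cell ‖Φ^τ‖² = 1`. [folklore] -/
theorem integral_norm_sq_transportFun {L : ℝ} (hL : 0 < L) {n : Fin 3 → ℤ} (hn : n ≠ 0)
    (Φ : PeriodicTrialState N L) (τ : ℝ) :
    ∫ X in cellN N L, ‖transportFun L n τ Φ.ψ X‖ ^ 2 = 1 := by
  have hc : Continuous fun X => ‖transportFun L n τ Φ.ψ X‖ ^ 2 :=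
    ((contDiff_transportFun L n τ Φ.contDiff).continuous.norm).pow 2
  have hint : Integrable (fun X => ‖transportFun L n τ Φ.ψ X‖ ^ 2) (volume.restrict (cellN N L)) :=
    integrableOn_cellN hc L
  have h := ofReal_integral_eq_lintegral_ofReal hint
    (Filter.Eventually.of_forall fun X => sq_nonneg _)
  simp_rw [← coe_nnnorm_sq_eq_ofReal] at h
  rw [lintegral_nnnorm_sq_transportFun hL hn Φ τ] at h
  have hnn : 0 ≤ ∫ X in cellN N L, ‖transportFun L n τ Φ.ψ X‖ ^ 2 :=
    integral_nonneg fun X => sq_nonneg _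
  have := congrArg ENNReal.toReal h
  rwa [ENNReal.toReal_ofReal hnn, ENNReal.toReal_one] at this

/-! ### The transported state -/

/-- The TRANSPORTED STATE `Φ^τ = Φ.transport hL hn τ`: the admissible periodic trial state with
wave function `transportFun L n τ Φ.ψ = (Φ ∘ F_{-τ}) · J_τ` (`C¹`, lattice periodic and Bose
symmetric by `stub_transportState`, normalised by `lintegral_nnnorm_sq_transportFun`; `L > 0` and
`n ≠ 0` make `|k|² ≠ 0`). A dot-notation extension of the Literature structure
`PeriodicTrialState`, deliberately declared with its absolute name. -/
def _root_.Literature.MathematicalPhysics.QuantumManyBody.BoseGas.PeriodicTrialState.transport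
    {L : ℝ} (Φ : PeriodicTrialState N L) (hL : 0 < L) {n : Fin 3 → ℤ} (hn : n ≠ 0) (τ : ℝ) :
    PeriodicTrialState N L where
  ψ := transportFun L n τ Φ.ψ
  contDiff := contDiff_transportFun L n τ Φ.contDiff
  periodic := transportFun_add_single L n τ Φ.periodic
  symm := transportFun_comp_perm L n τ Φ.symm
  norm_eq := lintegral_nnnorm_sq_transportFun hL hn Φ τ

/-- The wave function of the transported state is `Φ^τ`. [folklore] -/
@[simp] theorem _root_.Literature.MathematicalPhysics.QuantumManyBody.BoseGas.PeriodicTrialState.transport_ψ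
    {L : ℝ} (Φ : PeriodicTrialState N L) (hL : 0 < L) {n : Fin 3 → ℤ} (hn : n ≠ 0) (τ : ℝ) :
    (Φ.transport hL hn τ).ψ = transportFun L n τ Φ.ψ := rfl

/-- Two admissible states with the same wave function are equal (the other fields are
propositions). [folklore] -/
theorem _root_.Literature.MathematicalPhysics.QuantumManyBody.BoseGas.PeriodicTrialState.eq_of_ψ_eq
    {L : ℝ} : ∀ {Φ Ψ : PeriodicTrialState N L}, Φ.ψ = Ψ.ψ → Φ = Ψ
  | ⟨_, _, _, _, _⟩, ⟨_, _, _, _, _⟩, rfl => rfl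

/-- `Φ^0 = Φ`. [folklore] -/
theorem _root_.Literature.MathematicalPhysics.QuantumManyBody.BoseGas.PeriodicTrialState.transport_zero
    {L : ℝ} (Φ : PeriodicTrialState N L) (hL : 0 < L) {n : Fin 3 → ℤ} (hn : n ≠ 0) :
    Φ.transport hL hn 0 = Φ :=
  PeriodicTrialState.eq_of_ψ_eq (transportFun_zero L n Φ.ψ)

/-! ### The Jacobian cocycle and the group law -/

/-- The JACOBIAN COCYCLE of the angle flow: `D(s + t, θ) = D(t, θ) · D(s, θ + δ(t, θ))` for
`D(τ, θ) = cosh τ - cos θ sinh τ` (chain rule for `θ ↦ θ + δ` along the flow law; here from the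
cosine boost formula and the addition theorems). [folklore] -/
theorem jacFactor_add (s t θ : ℝ) :
    cosh (s + t) - cos θ * sinh (s + t) =
      (cosh t - cos θ * sinh t) * (cosh s - cos (θ + angleFlow t θ) * sinh s) := by
  have hc := cos_add_angleFlow_mul t θ
  rw [cosh_add, sinh_add]
  linear_combination sinh s * hc

/-- The cocycle for the factors of the weight: `cosh(τ+σ) + cos θ sinh(τ+σ) =
(cosh τ + cos θ sinh τ)(cosh σ + cos(θ + δ(-τ, θ)) sinh σ)` (`D(-τ-σ, θ) = D(-τ, θ) D(-σ, θ + δ(-τ, θ))`).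
[folklore] -/
theorem jacFactor_neg_add (τ σ θ : ℝ) :
    cosh (τ + σ) + cos θ * sinh (τ + σ) =
      (cosh τ + cos θ * sinh τ) * (cosh σ + cos (θ + angleFlow (-τ) θ) * sinh σ) := by
  have h := jacFactor_add (-σ) (-τ) θ
  simp only [cosh_neg, sinh_neg, mul_neg, sub_neg_eq_add] at h
  rw [show -σ + -τ = -(τ + σ) by ring, cosh_neg, sinh_neg, mul_neg, sub_neg_eq_add] at h
  exact h

/-- THE WEIGHT COCYCLE `J_{τ+σ}(X) = J_τ(X) · J_σ(F_{-τ} X)` (for `|k|² ≠ 0`). [folklore] -/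
theorem transportWeight_add {L : ℝ} {n : Fin 3 → ℤ} (hk : ksq L n ≠ 0) (τ σ : ℝ) (X : Config N) :
    transportWeight L n (τ + σ) X =
      transportWeight L n τ X * transportWeight L n σ (transportFlow L n (-τ) X) := by
  unfold transportWeight
  rw [← Finset.prod_mul_distrib]
  refine Finset.prod_congr rfl fun i _ => ?_
  rw [phase_transportFlow hk, jacFactor_neg_add τ σ,
    Real.sqrt_mul (jacFactor_neg_pos τ _).le, mul_inv]

/-- THE GROUP LAW `(Φ^σ)^τ = Φ^{τ+σ}` of the transport (`e^{-τD} e^{-σD} = e^{-(τ+σ)D}`): the flow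
law `F_{-σ} ∘ F_{-τ} = F_{-(τ+σ)}` and the weight cocycle. [folklore] -/
theorem transportFun_transportFun {L : ℝ} {n : Fin 3 → ℤ} (hk : ksq L n ≠ 0) (τ σ : ℝ)
    (ψ : Config N → ℂ) :
    transportFun L n τ (transportFun L n σ ψ) = transportFun L n (τ + σ) ψ := by
  funext X
  simp only [transportFun_apply]
  rw [transportFlow_add, transportWeight_add hk, neg_add_rev, Complex.ofReal_mul]
  ring

/-- The group law for transported states: `(Φ^σ)^τ = Φ^{τ+σ}`. [folklore] -/
theorem _root_.Literature.MathematicalPhysics.QuantumManyBody.BoseGas.PeriodicTrialState.transport_transport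
    {L : ℝ} (Φ : PeriodicTrialState N L) (hL : 0 < L) {n : Fin 3 → ℤ} (hn : n ≠ 0) (τ σ : ℝ) :
    (Φ.transport hL hn σ).transport hL hn τ = Φ.transport hL hn (τ + σ) :=
  PeriodicTrialState.eq_of_ψ_eq (transportFun_transportFun (ksq_pos hL.ne' hn).ne' τ σ Φ.ψ)

/-- The inverse law for transported states: `(Φ^τ)^{-τ} = Φ`. [folklore] -/
theorem _root_.Literature.MathematicalPhysics.QuantumManyBody.BoseGas.PeriodicTrialState.transport_neg_transport
    {L : ℝ} (Φ : PeriodicTrialState N L) (hL : 0 < L) {n : Fin 3 → ℤ} (hn : n ≠ 0) (τ : ℝ) :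
    (Φ.transport hL hn τ).transport hL hn (-τ) = Φ := by
  rw [PeriodicTrialState.transport_transport, neg_add_cancel, PeriodicTrialState.transport_zero]

/-! ### Flattening cell integrals against the transported density -/

section Flattening

variable {L : ℝ} {n : Fin 3 → ℤ}

/-- FLATTENING: `∫_cell g · |Φ^τ|² = ∫_cell (g ∘ F_τ) · |ψ|²` for a lattice-periodic weight `g`
(no measurability needed) and a lattice-periodic `ψ`: the Bochner torus change of variables
`X = F_τ(Y)` and `|Φ^τ(F_τ Y)|² det DF_τ(Y) = |ψ(Y)|²`. [folklore] -/
theorem integral_mul_norm_sq_transportFun (hL : 0 < L) (hk : ksq L n ≠ 0) (τ : ℝ)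
    {ψ : Config N → ℂ}
    (hψ : ∀ (X : Config N) (i : Fin N) (c : Fin 3),
      ψ (X + Pi.single i (EuclideanSpace.single c L)) = ψ X)
    {g : Config N → ℝ}
    (hg : ∀ (X : Config N) (i : Fin N) (c : Fin 3),
      g (X + Pi.single i (EuclideanSpace.single c L)) = g X) :
    ∫ X in cellN N L, g X * ‖transportFun L n τ ψ X‖ ^ 2 =
      ∫ Y in cellN N L, g (transportFlow L n τ Y) * ‖ψ Y‖ ^ 2 := by
  rw [← integral_cellN_comp_equivariant hL (hasFDerivAt_transportFlow L n τ)
    (bijective_transportFlow L n τ) (transportFlow_add_single L n τ)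
    (G := fun X => g X * ‖transportFun L n τ ψ X‖ ^ 2)
    (fun X i c => by simp only [hg, transportFun_add_single L n τ hψ])]
  refine integral_congr_ae (Filter.Eventually.of_forall fun Y => ?_)
  simp only [smul_eq_mul]
  rw [abs_of_pos (det_transportDeriv_pos hk τ Y), ← norm_sq_transportFun_transportFlow_mul_det hk τ ψ Y]
  ring

/-- The source weight `∑ᵢ 2cos θᵢ` is lattice periodic. [folklore] -/
theorem sum_cos_phase_add_single (L : ℝ) (n : Fin 3 → ℤ) (X : Config N) (i : Fin N) (c : Fin 3) :
    (∑ i', 2 * cos (phase L n (X + Pi.single i (EuclideanSpace.single c L)) i')) =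
      ∑ i', 2 * cos (phase L n X i') :=
  Finset.sum_congr rfl fun i' _ => by
    obtain ⟨m, hm⟩ := exists_phase_add_single L n X i c i'
    rw [hm, cos_add_int_mul_two_pi]

/-- The weight `∑ᵢ 2sin² θᵢ` of `N_eff` is lattice periodic. [folklore] -/
theorem sum_sin_sq_phase_add_single (L : ℝ) (n : Fin 3 → ℤ) (X : Config N) (i : Fin N)
    (c : Fin 3) :
    (∑ i', 2 * sin (phase L n (X + Pi.single i (EuclideanSpace.single c L)) i') ^ 2) =
      ∑ i', 2 * sin (phase L n X i') ^ 2 :=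
  Finset.sum_congr rfl fun i' _ => by
    obtain ⟨m, hm⟩ := exists_phase_add_single L n X i c i'
    rw [hm, sin_add_int_mul_two_pi]

/-- `m(Ψ) = ∫ (∑ᵢ 2cos θᵢ)|Ψ|²` with the phases spelled `phase L n X i`. [folklore] -/
theorem sourceMean_eq_integral (n : Fin 3 → ℤ) (Ψ : PeriodicTrialState N L) :
    sourceMean n Ψ = ∫ X in cellN N L, (∑ i, 2 * cos (phase L n X i)) * ‖Ψ.ψ X‖ ^ 2 := rfl

/-- FLATTENED DENSITY WAVE: `m(Φ^τ) = ∫ (∑ᵢ 2cos(θᵢ + δ(τ, θᵢ))) |Φ|²`. [folklore] -/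
theorem sourceMean_transport (hL : 0 < L) (hn : n ≠ 0) (Φ : PeriodicTrialState N L) (τ : ℝ) :
    sourceMean n (Φ.transport hL hn τ) = ∫ Y in cellN N L,
      (∑ i, 2 * cos (phase L n Y i + angleFlow τ (phase L n Y i))) * ‖Φ.ψ Y‖ ^ 2 := by
  have hk : ksq L n ≠ 0 := (ksq_pos hL.ne' hn).ne'
  rw [sourceMean_eq_integral, PeriodicTrialState.transport_ψ,
    integral_mul_norm_sq_transportFun hL hk τ Φ.periodic (sum_cos_phase_add_single L n)]
  simp_rw [phase_transportFlow hk]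

/-- FLATTENED EFFECTIVE NUMBER: `N_eff(Φ^τ) = ∫ (∑ᵢ 2sin²(θᵢ + δ(τ, θᵢ))) |Φ|²`. [folklore] -/
theorem effNumber_transport (hL : 0 < L) (hn : n ≠ 0) (Φ : PeriodicTrialState N L) (τ : ℝ) :
    effNumber n (Φ.transport hL hn τ) = ∫ Y in cellN N L,
      (∑ i, 2 * sin (phase L n Y i + angleFlow τ (phase L n Y i)) ^ 2) * ‖Φ.ψ Y‖ ^ 2 := by
  have hk : ksq L n ≠ 0 := (ksq_pos hL.ne' hn).ne'
  rw [effNumber, PeriodicTrialState.transport_ψ,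
    integral_mul_norm_sq_transportFun hL hk τ Φ.periodic (sum_sin_sq_phase_add_single L n)]
  simp_rw [phase_transportFlow hk]

end Flattening

/-! ### The registered sub-goal -/

/-- **Registered sub-goal `stub_transportedState` of S1** (line `force-balance-constitutive`, crux
stmt-AtomisticToContinuum-9481): for `L > 0` and a mode `n ≠ 0`, the transported wave function
`Φ^τ = (Φ ∘ F_{-τ}) · J_τ` of an admissible periodic state is normalised on the cell,
`∫_cell ‖Φ^τ‖₊² = 1` (so `Φ^τ` is again admissible: `PeriodicTrialState.transport`), and the
transport is a one-parameter group, `(Φ^σ)^τ = Φ^{τ+σ}`. [folklore] -/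
theorem stub_transportedState : ∀ (N : ℕ) (L : ℝ) (n : Fin 3 → ℤ), 0 < L → n ≠ 0 →
    ∀ (τ σ : ℝ) (Φ : Literature.MathematicalPhysics.QuantumManyBody.BoseGas.PeriodicTrialState N L),
    (∫⁻ X in Literature.MathematicalPhysics.QuantumManyBody.BoseGas.cellN N L,
        (‖transportFun L n τ Φ.ψ X‖₊ : ENNReal) ^ 2 = 1) ∧
    transportFun L n τ (transportFun L n σ Φ.ψ) = transportFun L n (τ + σ) Φ.ψ :=
  fun _ _ _ hL hn τ σ Φ =>
    ⟨lintegral_nnnorm_sq_transportFun hL hn Φ τ, transportFun_transportFun (ksq_pos hL.ne' hn).ne' τ σ Φ.ψ⟩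

end

end Summit.AtomisticToContinuum.BoseEinsteinCondensation.Cruxes.DensityResponse.ForceBalanceConstitutive
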